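import Summits.HodgeConjecture.HodgeConjecture.Theorems.PadicSemiregularLiftHodgeAbelianVarietiesStubWeilSectorSuffices
import Summits.HodgeConjecture.HodgeConjecture.Theorems.PadicSemiregularLiftHodgeAbelianVarietiesStubAndreCM
import Literature.AlgebraicGeometry.HodgeTheory.AbelianVarietyPullbackAlgebraicClasses
import Literature.AlgebraicGeometry.HodgeTheory.HodgeClassesDimLEThreeOfGAGA
import Literature.AlgebraicGeometry.HodgeTheory.HardLefschetzNFoldHolds

/-!
# Crux `HodgeAbelianVarieties` (stmt-HodgeConjecture-1333), line `prym-canonical-z3-split-seeds` — stub `stub_weilSectorSuffices`: the CM sector with its dischargeable hypotheses discharged, and the exact residual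

The registered stub (skeleton `Cruxes/HodgeAbelianVarieties/Lines/prym_canonical_z3_split_seeds.lean`,
STUB 6, byte-identical with the e-step line's gen-3 stub) is the PARKED COMPLEMENT
`WeilSectorSuffices := TropicalCuspLift.WeilClassesAlgebraic → PadicSemiregularLift.HodgeAbelianVarieties`
(the imaginary-quadratic Weil sector implies the Hodge conjecture for every complex abelian variety).
It is OPEN and is NOT proved here. Its known partials are landed in
`Theorems/PadicSemiregularLiftHodgeAbelianVarietiesStubWeilSectorSuffices` (p97654: `dim ≤ 5` modulo
the Moonen–Zarhin named fact, `dim ≤ 3`, divisor-generated Hodge rings, and the residual form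
`weilSectorSuffices_of_six_le_dim`), and the CM sector in
`Theorems/PadicSemiregularLiftHodgeAbelianVarietiesStubAndreCM` (`stub_andreCM_of_andre_of_homPullback :
(∀ n X, nonempty_hodgeModel n X) → CMWeil[] → AndreSplitWeil[] → HomPullback[] → HCCM[]`, André's 1992
reduction of the Hodge conjecture for CM abelian varieties to Weil classes of split-Weil-type CM
abelian varieties, CONDITIONAL on its four antecedents).

This file (sorry-free, no new definition, no new named fact) AUDITS those antecedents against
today's tree and DISCHARGES the two that have meanwhile become theorems:

* `homPullback_holds : HomPullback[]` (REGISTERED helper) — **pull-back of algebraic classes along a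
  homomorphism of complex abelian varieties is algebraic**, `f^*(Nᵖ H²ᵖ(B)) ⊆ Nᵖ H²ᵖ(A)` for
  `f : A ⟶ B` (Voisin II Prop. 9.21 (i) / Fulton Cor. 19.2 (b) on the support carrier), now a
  THEOREM of the tree: `Literature.AlgebraicGeometry.HodgeTheory.map_mem_algebraicClasses_of_abelianVariety`
  (file `AbelianVarietyPullbackAlgebraicClasses`: pull-back along ANY morphism from a smooth projective
  variety to an abelian variety preserves `Nᵖ H²ᵖ`, by Kleiman's general translate, Fulton App.
  B.9.2 (a)) applied to the scheme morphism `f.hom.hom.hom : A.X ⟶ B.X` underlying `f`, `A.X` being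
  smooth projective (`AbelianVariety.isSmoothProjective_holds`). The closed-immersion half that
  `homPullback_of_flat` lacked is thereby supplied.
* the Hodge-model antecedent `∀ n X, nonempty_hodgeModel n X` is the Literature theorem
  `nonempty_hodgeModel_holds` (Serre GAGA + de Rham + Hodge decomposition; file
  `ComplexConjugationHolds`), fed in directly.
* `stub_andreCM_of_andre : CMWeil[] → AndreSplitWeil[] → HCCM[]` (REGISTERED helper) — André's
  reduction with BOTH dischargeable antecedents discharged: the Hodge conjecture for CM abelian
  varieties now rests on exactly two hypotheses, `CMWeil[]` (Weil classes algebraic for every CM-field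
  action — OPEN in print beyond the imaginary-quadratic fields, Markman's survey Thm. 1.4 / §12) and
  `AndreSplitWeil[]` (André 1992 = Markman's survey Thm. 1.4, a THEOREM in print, typed verbatim as in
  the landed file; unformalised: it needs the uniformisation `H•(A) = ⋀• H¹` with its `End⁰(A)`-action
  and the Serre tensor construction of the split-Weil-type CM varieties `Bᵢ`).
* `weilSectorSuffices_of_andre_of_nonCM` (REGISTERED helper) — **the exact residual of the stub**:
  granted the Moonen–Zarhin named fact (for `dim ≤ 5`), `CMWeil[]` and `AndreSplitWeil[]` (for the CM
  abelian varieties of dimension `≥ 6`), the stub `WeilClassesAlgebraic → HodgeAbelianVarieties` holds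
  as soon as the Hodge conjecture holds for the NON-CM abelian varieties of dimension `≥ 6` — the
  "CM-to-general transport", for which print has no mechanism (the Hodge conjecture is not known to
  spread from the CM points of `𝒜_g`, `g ≥ 6`, to a general member: the algebraicity locus of a
  variation of Hodge structure is a countable union of closed algebraic subsets, Cattani–Deligne–Kaplan,
  and density of CM points gives nothing without variational Hodge). Under the same three hypotheses
  the crux is EQUIVALENT to that non-CM statement (`hodgeAbelianVarieties_iff_nonCM_six_le_dim`), and
  the non-CM statement is itself implied by the crux (`nonCM_six_le_dim_of_hodgeAbelianVarieties`), so
  nothing stronger than the crux has been assumed.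
* `hodgeAbelianVarieties_dim_le_three_of_serreGAGA` (REGISTERED helper) — the `dim ≤ 3` partial with
  its hard-Lefschetz input DISCHARGED (`nonempty_hardLefschetzNFold_holds`, file
  `HardLefschetzNFoldHolds`): `dim A ≤ 3` now rests on the single named leaf
  `serreGAGA_lineCocycle_iso_cartierDivisorCocycle` (GAGA for line bundles, Serre 1956 n° 20 Prop. 18,
  whence Lefschetz `(1,1)`, `lefschetzOneOne_rational_of_serreGAGA`); and
  `hodgeAbelianVarieties_dim_le_three_of_lefschetzOneOne` is the registered
  `hodgeAbelianVarieties_dim_le_three_of_lefschetz` without its second hypothesis.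

RESIDUAL of `stub_weilSectorSuffices` after this file (census for the lead). The stub reduces to, and
nothing in the tree reduces it further than:
(a) `MoonenZarhin1999_hodgeClasses_abelian_dim_le_five_of_weilClassesFourfolds` (named fact; in the
    tree it is in turn `serreGAGA_lineCocycle_iso_cartierDivisorCocycle` + the codimension-`2` parts of
    Moonen–Zarhin's Thms. 0.1–0.2 as a hypothesis, `…_of_serreGAGA` in
    `AbelianLowDimensionWeilReductionProofs`) — dimension `≤ 5`;
(b) `CMWeil[]` — Weil classes for CM fields of EVERY degree (the route antecedent is the
    imaginary-quadratic case only; degree `> 2` is open in print);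
(c) `AndreSplitWeil[]` — André 1992 (theorem in print, hypothesis here);
(d) the CM-to-general transport `∀ A, 6 ≤ A.dim → ¬ IsCM[A] → HodgeConjectureFor A.dim A.X` — OPEN, no
    mechanism in print.
DISCHARGED today: `HomPullback[]`, `nonempty_hodgeModel`, hard Lefschetz (`n`-fold). Not attempted:
(a)–(d) themselves.
-/

-- every declaration of this problem lives in `Summit.HodgeConjecture.HodgeConjecture.…` (single-problem summit)
set_option linter.dupNamespace false

noncomputable section

open CategoryTheory AlgebraicGeometry
open Literature.AlgebraicGeometry Literature.AlgebraicGeometry.Motives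
  Literature.AlgebraicGeometry.HodgeTheory

namespace Summit.HodgeConjecture.HodgeConjecture.Cruxes.HodgeAbelianVarieties.PrymCanonicalZ3SplitSeeds.Stubs.WeilSectorSufficesCM

open Summit.HodgeConjecture.HodgeConjecture.Cruxes.HodgeAbelianVarieties.SubtorusGalleryBlochSeeds.Stubs
open Summit.HodgeConjecture.HodgeConjecture.Cruxes.HodgeAbelianVarieties.EStepSecantInduction.Stubs.WeilSector

/-! ### The shared statements (local notations, copied verbatim from `…StubAndreCM`) -/

/-- `CMWeil[]` — Weil classes are algebraic for every CM-field action, on the tree's real carriers: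
for `ψ ∈ End(A)` whose pull-back on `H¹(A(ℂ); ℂ)` is semisimple with non-real eigenvalues `μ ∈ S`,
each of multiplicity exactly `2p`, every rational `(p,p)`-class in the span of the top-wedge
eigenclass lines `⋀^{2p} H¹_μ = pullbackEigenclasses A ψ (2p) ((x,y) ↦ (x + yμ)^{2p})` is algebraic
(van Geemen 4.8–4.9; Deligne–Milne LNM 900 (4.3)–(4.4)). Local notation only (verbatim copy of the
landed file's, hence of the skeleton's). -/
local notation3 (prettyPrint := false) "CMWeil[]" =>
  ∀ (A : AbelianVariety ℂ) (ψ : A ⟶ A) (p : ℕ) (S : Finset ℂ), 0 < p →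
    (∀ μ ∈ S, μ.im ≠ 0) →
    (⨆ μ ∈ S, Module.End.eigenspace (HodgeTheory.complexBetti.map ψ.hom.hom.hom 1).hom μ) = ⊤ →
    (∀ μ ∈ S, Module.finrank ℂ
        (Module.End.eigenspace (HodgeTheory.complexBetti.map ψ.hom.hom.hom 1).hom μ) = 2 * p) →
    ∀ c : HodgeTheory.complexBetti A.X (2 * p), HodgeTheory.IsRationalClass c →
      HodgeTheory.IsOfHodgeType A.dim A.X (2 * p) p p c →
      c ∈ (⨆ μ ∈ S, HodgeTheory.pullbackEigenclasses A ψ (2 * p)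
              (fun x y => ((x : ℂ) + (y : ℂ) * μ) ^ (2 * p))) →
      c ∈ HodgeTheory.algebraicClasses A.X p

/-- `IsCM[A]` — `A` is of CM type: some endomorphism of `A` has `2 · dim A` distinct eigenvalues on
`H¹(A(ℂ); ℂ)` (Mumford, *Abelian Varieties* §22; Markman survey §1.1). Local notation only (verbatim
copy of the landed file's). -/
local notation3 (prettyPrint := false) "IsCM[" A "]" =>
  ∃ (ψ : A ⟶ A) (μ : Fin (2 * AbelianVariety.dim A) → ℂ), Function.Injective μ ∧
    ∀ i, Module.End.HasEigenvalue (HodgeTheory.complexBetti.map ψ.hom.hom.hom 1).hom (μ i)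

/-- `HCCM[]` — the Hodge conjecture for complex abelian varieties of CM type. Local notation only
(verbatim copy of the landed file's). -/
local notation3 (prettyPrint := false) "HCCM[]" =>
  ∀ A : AbelianVariety ℂ, IsCM[A] → HodgeTheory.HodgeConjectureFor A.dim A.X

/-- `AndreSplitWeil[]` — André's decomposition typed on the tree's carriers in the antecedent shape of
`CMWeil[]` (HYPOTHESIS, not asserted): every rational `(p,p)`-class (`0 < p`) on a CM abelian variety
is a finite sum `Σ fᵢ^* tᵢ` of pull-backs along homomorphisms `fᵢ : A ⟶ Bᵢ` of rational `(p,p)` Weil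
classes `tᵢ` of `(Bᵢ, ℚ(ψᵢ))`. Local notation only (verbatim copy of the landed file's).
[cite: Andre1992HodgeCM, Théorème (pp. 1–7)] [cite: Markman2025SurveySecant, Thm. 1.4] -/
local notation3 (prettyPrint := false) "AndreSplitWeil[]" =>
  ∀ (A : AbelianVariety ℂ), IsCM[A] → ∀ (p : ℕ), 0 < p →
    ∀ c : HodgeTheory.complexBetti A.X (2 * p), HodgeTheory.IsRationalClass c →
      HodgeTheory.IsOfHodgeType A.dim A.X (2 * p) p p c →
      ∃ (m : ℕ) (B : Fin m → AbelianVariety ℂ) (f : ∀ i, A ⟶ B i) (ψ : ∀ i, B i ⟶ B i)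
        (S : Fin m → Finset ℂ) (t : ∀ i, HodgeTheory.complexBetti (B i).X (2 * p)),
        (∀ i, ∀ μ ∈ S i, μ.im ≠ 0) ∧
        (∀ i, (⨆ μ ∈ S i, Module.End.eigenspace
            (HodgeTheory.complexBetti.map (ψ i).hom.hom.hom 1).hom μ) = ⊤) ∧
        (∀ i, ∀ μ ∈ S i, Module.finrank ℂ (Module.End.eigenspace
            (HodgeTheory.complexBetti.map (ψ i).hom.hom.hom 1).hom μ) = 2 * p) ∧
        (∀ i, HodgeTheory.IsRationalClass (t i)) ∧
        (∀ i, HodgeTheory.IsOfHodgeType (B i).dim (B i).X (2 * p) p p (t i)) ∧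
        (∀ i, t i ∈ ⨆ μ ∈ S i, HodgeTheory.pullbackEigenclasses (B i) (ψ i) (2 * p)
            (fun x y => ((x : ℂ) + (y : ℂ) * μ) ^ (2 * p))) ∧
        c = ∑ i, HodgeTheory.complexBetti.map (f i).hom.hom.hom (2 * p) (t i)

/-- `HomPullback[]` — pull-back along a homomorphism of complex abelian varieties preserves algebraic
classes (Voisin II Prop. 9.21 (i) on the support carrier `Nᵖ H²ᵖ`). Local notation only (verbatim
copy of the landed file's); PROVED below (`homPullback_holds`). [cite: VoisinHodgeII2003, Prop. 9.21 (i)] -/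
local notation3 (prettyPrint := false) "HomPullback[]" =>
  ∀ (A B : AbelianVariety ℂ) (f : A ⟶ B) (p : ℕ) (a : HodgeTheory.complexBetti B.X (2 * p)),
    a ∈ HodgeTheory.algebraicClasses B.X p →
      HodgeTheory.complexBetti.map f.hom.hom.hom (2 * p) a ∈ HodgeTheory.algebraicClasses A.X p

/-! ### Discharge 1: `HomPullback[]` is a theorem -/

/-- **REGISTERED helper — `HomPullback[]` holds**: for a homomorphism `f : A ⟶ B` of complex abelian
varieties and `a ∈ Nᵖ H²ᵖ(B(ℂ); ℂ)`, `f^* a ∈ Nᵖ H²ᵖ(A(ℂ); ℂ)`. This is the tree's theorem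
`map_mem_algebraicClasses_of_abelianVariety` (pull-back along any `ℂ`-morphism from a smooth
projective variety to an abelian variety preserves the support filtration: factor through the flat
shear `X × B → B` and a general slice, Kleiman's general translate) at the scheme morphism
`f.hom.hom.hom : A.X ⟶ B.X`, `A.X` being smooth projective (`AbelianVariety.isSmoothProjective_holds`).
In print: Voisin II Prop. 9.21 (i) "`i^* cl(Z) = cl(i^* Z)`" / Fulton Cor. 19.2 (b).
[cite: VoisinHodgeII2003, Prop. 9.21 (i)] [cite: Fulton1998, §19.2 Cor. 19.2 (b) and Appendix B.9.2 (a)] -/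
theorem homPullback_holds : HomPullback[] :=
  fun A B f _ _ ha ↦
    map_mem_algebraicClasses_of_abelianVariety (AbelianVariety.isSmoothProjective_holds (A := A)) B
      f.hom.hom.hom ha

/-! ### Discharge 2: Hodge models exist; André's reduction on two hypotheses -/

/-- **REGISTERED helper — André's reduction with its dischargeable antecedents discharged**:
`CMWeil[] → AndreSplitWeil[] → HCCM[]`. This is the landed `stub_andreCM_of_andre_of_homPullback`
(`(∀ n X, nonempty_hodgeModel n X) → CMWeil[] → AndreSplitWeil[] → HomPullback[] → HCCM[]`) fed with the
Literature theorem `nonempty_hodgeModel_holds` (every smooth projective complex variety has a Hodge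
model: Serre GAGA, de Rham, Hodge decomposition) and with `homPullback_holds`. What remains assumed
is exactly André's theorem (`AndreSplitWeil[]`, André 1992 = Markman's survey Thm. 1.4) and the
algebraicity of Weil classes for all CM-field actions (`CMWeil[]`, open in print for CM fields of
degree `> 2`). [cite: Andre1992HodgeCM, Théorème (pp. 1–7)] [cite: Markman2025SurveySecant, Thm. 1.4]
[cite: VoisinHodgeII2003, Prop. 9.21 (i)] -/
theorem stub_andreCM_of_andre : CMWeil[] → AndreSplitWeil[] → HCCM[] :=
  fun hW hAndre ↦
    stub_andreCM_of_andre_of_homPullback (fun _ _ ↦ nonempty_hodgeModel_holds) hW hAndre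
      homPullback_holds

/-- **Pointwise form**: granted `CMWeil[]` and `AndreSplitWeil[]`, every rational `(p,p)`-class on a
complex abelian variety of CM type is algebraic (all `p`; `p = 0` is `N⁰ H⁰ = H⁰`).
[cite: Andre1992HodgeCM, Théorème (pp. 1–7)] -/
theorem mem_algebraicClasses_of_isCM (hW : CMWeil[]) (hAndre : AndreSplitWeil[]) (A : AbelianVariety ℂ)
    (hA : IsCM[A]) (p : ℕ) (c : HodgeTheory.complexBetti A.X (2 * p)) (hc : HodgeTheory.IsRationalClass c)
    (hh : HodgeTheory.IsOfHodgeType A.dim A.X (2 * p) p p c) : c ∈ HodgeTheory.algebraicClasses A.X p :=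
  (stub_andreCM_of_andre hW hAndre A hA).2 p c hc hh

/-! ### The exact residual of the stub: the CM-to-general transport in dimension `≥ 6` -/

/-- **CM plus non-CM is everything**: `HCCM[]` and the Hodge conjecture for the non-CM abelian
varieties give the crux `HodgeAbelianVarieties` (`= ∀ A, HodgeConjectureFor A.dim A.X` by `Iff.rfl`).
[folklore] -/
theorem hodgeAbelianVarieties_of_hccm_of_nonCM (hCM : HCCM[])
    (hnc : ∀ A : AbelianVariety ℂ, ¬ IsCM[A] → HodgeTheory.HodgeConjectureFor A.dim A.X) :
    Summit.HodgeConjecture.HodgeConjecture.Theses.PadicSemiregularLift.HodgeAbelianVarieties := by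
  intro A
  by_cases hA : IsCM[A]
  · exact hCM A hA
  · exact hnc A hA

/-- **Granted `CMWeil[]` and André, the crux is its non-CM part.** [cite: Andre1992HodgeCM, Théorème (pp. 1–7)] -/
theorem hodgeAbelianVarieties_iff_nonCM (hW : CMWeil[]) (hAndre : AndreSplitWeil[]) :
    Summit.HodgeConjecture.HodgeConjecture.Theses.PadicSemiregularLift.HodgeAbelianVarieties ↔
      ∀ A : AbelianVariety ℂ, ¬ IsCM[A] → HodgeTheory.HodgeConjectureFor A.dim A.X :=
  ⟨fun h A _ ↦ h A, hodgeAbelianVarieties_of_hccm_of_nonCM (stub_andreCM_of_andre hW hAndre)⟩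

/-- **Granted Moonen–Zarhin, the Weil sector, `CMWeil[]` and André, the crux is EXACTLY the Hodge
conjecture for non-CM abelian varieties of dimension `≥ 6`** — the CM-to-general transport, open in
print with no mechanism: dimension `≤ 5` is `weilSectorSuffices_dim_le_five` (Moonen–Zarhin + the
fourfold Weil theorem, which the route antecedent contains at `n = 2`), CM of any dimension is
`stub_andreCM_of_andre`. [cite: MoonenZarhin1999LowDim, Thm. 0.1 and Thm. 0.2]
[cite: Markman2025SurveySecant, Cor. 1.3 and Thm. 1.4] [cite: Andre1992HodgeCM, Théorème (pp. 1–7)] -/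
theorem hodgeAbelianVarieties_iff_nonCM_six_le_dim
    (hMZ : MoonenZarhin1999_hodgeClasses_abelian_dim_le_five_of_weilClassesFourfolds)
    (hWCA : Summit.HodgeConjecture.HodgeConjecture.Theses.TropicalCuspLift.WeilClassesAlgebraic)
    (hW : CMWeil[]) (hAndre : AndreSplitWeil[]) :
    Summit.HodgeConjecture.HodgeConjecture.Theses.PadicSemiregularLift.HodgeAbelianVarieties ↔
      ∀ A : AbelianVariety ℂ, 6 ≤ A.dim → ¬ IsCM[A] → HodgeTheory.HodgeConjectureFor A.dim A.X := by
  refine ⟨fun h A _ _ ↦ h A, fun hnc ↦ (hodgeAbelianVarieties_iff_six_le_dim hMZ hWCA).2 fun A h6 ↦ ?_⟩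
  by_cases hA : IsCM[A]
  · exact stub_andreCM_of_andre hW hAndre A hA
  · exact hnc A h6 hA

/-- **REGISTERED helper — the exact residual form of `stub_weilSectorSuffices`.** Granted
(a) the Moonen–Zarhin named fact (dimension `≤ 5` from the Weil classes of fourfolds),
(b) `CMWeil[]` (Weil classes algebraic for every CM-field action; open in print beyond the
imaginary-quadratic fields of the route antecedent), (c) `AndreSplitWeil[]` (André 1992, theorem in
print) and (d) the Hodge conjecture for NON-CM abelian varieties of dimension `≥ 6` (the CM-to-general
transport — OPEN, no mechanism in print), the stub
`TropicalCuspLift.WeilClassesAlgebraic → PadicSemiregularLift.HodgeAbelianVarieties` holds. The two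
further antecedents of the landed CM reduction, `HomPullback[]` and the existence of Hodge models, are
theorems (`homPullback_holds`, `nonempty_hodgeModel_holds`) and no longer appear. Under (a)–(c) the
residual (d) is also NECESSARY (`hodgeAbelianVarieties_iff_nonCM_six_le_dim`).
[cite: MoonenZarhin1999LowDim, Thm. 0.1 and Thm. 0.2] [cite: Andre1992HodgeCM, Théorème (pp. 1–7)]
[cite: Markman2025SurveySecant, Cor. 1.3 and Thm. 1.4] -/
theorem weilSectorSuffices_of_andre_of_nonCM :
    Literature.AlgebraicGeometry.HodgeTheory.MoonenZarhin1999_hodgeClasses_abelian_dim_le_five_of_weilClassesFourfolds → CMWeil[] → AndreSplitWeil[] → (∀ A : AbelianVariety ℂ, 6 ≤ A.dim → ¬ IsCM[A] → HodgeTheory.HodgeConjectureFor A.dim A.X) → Summit.HodgeConjecture.HodgeConjecture.Theses.TropicalCuspLift.WeilClassesAlgebraic → Summit.HodgeConjecture.HodgeConjecture.Theses.PadicSemiregularLift.HodgeAbelianVarieties :=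
  fun hMZ hW hAndre hnc hWCA ↦ (hodgeAbelianVarieties_iff_nonCM_six_le_dim hMZ hWCA hW hAndre).2 hnc

/-- **The residual hypothesis is implied by the crux** (restrict the binder), hence by the Hodge
conjecture: assuming it is not assuming anything beyond the statement under attack, and it cannot be
refuted without refuting HC for abelian varieties. [folklore] -/
theorem nonCM_six_le_dim_of_hodgeAbelianVarieties
    (h : Summit.HodgeConjecture.HodgeConjecture.Theses.PadicSemiregularLift.HodgeAbelianVarieties) :
    ∀ A : AbelianVariety ℂ, 6 ≤ A.dim → ¬ IsCM[A] → HodgeTheory.HodgeConjectureFor A.dim A.X :=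
  fun A _ _ ↦ h A

/-- **All four residual hypotheses (b)–(d) and the route antecedent are consequences of the crux**
(with (a) a fragment of the Hodge conjecture for all smooth projective varieties,
`MoonenZarhin1999_…_of_hodgeConjectureFor`): the reduction `weilSectorSuffices_of_andre_of_nonCM`
trades the stub for statements each of which the crux implies — `CMWeil[]`
(`cmWeil_of_hodgeAbelianVarieties`), the antecedent (`weilClassesAlgebraic_of_hodgeAbelianVarieties`),
the non-CM transport (`nonCM_six_le_dim_of_hodgeAbelianVarieties`); André's `AndreSplitWeil[]` is a
theorem in print. [folklore] -/
theorem residual_of_hodgeAbelianVarieties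
    (h : Summit.HodgeConjecture.HodgeConjecture.Theses.PadicSemiregularLift.HodgeAbelianVarieties) :
    CMWeil[] ∧ Summit.HodgeConjecture.HodgeConjecture.Theses.TropicalCuspLift.WeilClassesAlgebraic ∧
      (∀ A : AbelianVariety ℂ, 6 ≤ A.dim → ¬ IsCM[A] → HodgeTheory.HodgeConjectureFor A.dim A.X) ∧
      HCCM[] :=
  ⟨cmWeil_of_hodgeAbelianVarieties h, weilClassesAlgebraic_of_hodgeAbelianVarieties h,
    nonCM_six_le_dim_of_hodgeAbelianVarieties h, hccm_of_hodgeAbelianVarieties h⟩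

/-! ### Discharge 3: hard Lefschetz in the `dim ≤ 3` partial -/

/-- **`dim A ≤ 3` from Lefschetz `(1,1)` alone** — the registered
`hodgeAbelianVarieties_dim_le_three_of_lefschetz` with its hard-Lefschetz hypothesis
`∀ X, nonempty_hardLefschetzThreefold X` DISCHARGED by the tree's theorem
`nonempty_hardLefschetzNFold_holds 3 X` (Kähler identities on a Hodge model, file
`HardLefschetzNFoldHolds`) through `hodgeClasses_algebraic_of_dim_le_three_of_nFold`.
[cite: VoisinHodgeII2003, §10.2.3 proof of Prop. 10.26] [cite: VoisinHodgeI2002, Thm. 6.25 and Thm. 11.30] -/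
theorem hodgeAbelianVarieties_dim_le_three_of_lefschetzOneOne (h1 : lefschetzOneOne_rational)
    (A : AbelianVariety ℂ) (hd : A.dim ≤ 3) : HodgeTheory.HodgeConjectureFor A.dim A.X :=
  hodgeAbelianVarieties_dim_le_three
    (hodgeClasses_algebraic_of_dim_le_three_of_nFold h1 fun X ↦ nonempty_hardLefschetzNFold_holds 3 X) A hd

/-- **REGISTERED helper — `dim A ≤ 3` from the one named leaf GAGA for line bundles**
(`serreGAGA_lineCocycle_iso_cartierDivisorCocycle`, Serre 1956 n° 20 Prop. 18, whence Lefschetz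
`(1,1)` by `lefschetzOneOne_rational_of_serreGAGA`; hard Lefschetz and Hodge models are theorems):
the honest trust base of the `dim ≤ 3` part of the crux in today's tree.
[cite: SerreGAGA1956, n° 20 Prop. 18] [cite: VoisinHodgeII2003, §10.2.3 proof of Prop. 10.26] -/
theorem hodgeAbelianVarieties_dim_le_three_of_serreGAGA :
    Literature.AlgebraicGeometry.HodgeTheory.serreGAGA_lineCocycle_iso_cartierDivisorCocycle → ∀ A : AbelianVariety ℂ, A.dim ≤ 3 → HodgeTheory.HodgeConjectureFor A.dim A.X :=
  fun hG A hd ↦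
    hodgeAbelianVarieties_dim_le_three
      (hodgeClasses_algebraic_of_dim_le_three_of_serreGAGA hG fun X ↦ nonempty_hardLefschetzNFold_holds 3 X)
      A hd

end Summit.HodgeConjecture.HodgeConjecture.Cruxes.HodgeAbelianVarieties.PrymCanonicalZ3SplitSeeds.Stubs.WeilSectorSufficesCM

end
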